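import Mathlib
import HarnessLib
import Summits.HodgeConjecture.HodgeConjecture.Theorems.HodgeLocusCensusExSet83Certs
import Summits.HodgeConjecture.HodgeConjecture.Theorems.HodgeLocusCensusExSet632

/-!
# HodgeLocusCensusExSet44Certs — §2 of the fourfold characteristic-0 exceptional-set anchor (cells (4,4,1), (4,4,0), (4,5,1))

certified instances and evidence bearing on the general Hodge conjecture; no claim.

One of three files forming the anchor described in the module docstring of `HodgeLocusCensusExSet44Char0` (record
`run/shared/lean/pub/pub-hlocus/pub-hlocus-ivhs-2/gen24/record/M44-CHAR0-g24.md`).  This file: the certificate polynomials g₁ (tangent-rank drops) and g₂ (obstruction-rank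
drops) of BOTH implementations at the three points X as integer coefficient lists (recorded program output), their factorisations and complex zero
sets (kernel-checked), and the kernel-checked COINCIDENCE of implementation B's characteristic-0 factorisations with the modulo-p rows found at RANDOM
smooth X of the same cells in generation 21 (`ExSet632.exRows`, program exsetE.py, kit j137462).  Nothing here is a statement about the Hodge conjecture.
-/

namespace Summit.HodgeConjecture.HodgeConjecture.HodgeLocus.Census.ExSet44Char0

open Summit.HodgeConjecture.HodgeConjecture.HodgeLocus.Census.ExSet83Char0 (evalCoeffs smul_pow_mul_pow_eq_zero_iff smul_pow_eq_zero_iff cert_prod_eq_zero_iff cert_prod_eq_zero_iff₀)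
open Summit.HodgeConjecture.HodgeConjecture.HodgeLocus.Census.ExSet632 (exRows signRule)

/-! ## 2. Certificate polynomials of the two implementations and their complex zero sets -/

/-- g₁ of implementation A at L441a (cell (4,4,1)): gcd of the 1 non-zero among 801 computed 9×9 minors of B(λ) (pivot minors at ten λ₀, then random; normalised), low degree first. -/
def g1A441 : List ℤ :=
  [0, 0, 0, -1, 1]

/-- `g1A441` is the coefficient list of λ^3·(λ − (1))^1. -/
theorem eval_g1A441 (z : ℂ) : evalCoeffs g1A441 z = (1:ℂ) * z ^ 3 * (z - (1:ℂ)) ^ 1 := by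
  simp [evalCoeffs, g1A441, List.zipIdx]; ring

/-- g₂ of implementation A at L441a: gcd of the 1 non-zero among 481 computed maximal (size-12) minors of [B(λ) | sym q(λ)] over A's minimal kernel basis (max degree 10). -/
def g2A441 : List ℤ :=
  [0, 0, 0, 0, 0, 0, 1, -4, 6, -4, 1]

/-- `g2A441` is the coefficient list of λ^6·(λ − (1))^4. -/
theorem eval_g2A441 (z : ℂ) : evalCoeffs g2A441 z = (1:ℂ) * z ^ 6 * (z - (1:ℂ)) ^ 4 := by
  simp [evalCoeffs, g2A441, List.zipIdx]; ring

/-- CHARACTERISTIC-0 STATEMENT (cell (4,4,1) at X = L441a, implementation A): the complex zero set of g₁·g₂ — the finite λ (engine normalisation =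
geometric, `…Char0` §4) at which the tangent rank or the quadratic-obstruction rank of V_λ at X can drop below its generic value — is exactly {0, 1}. -/
theorem certificate_zero_set_441A : {z : ℂ | evalCoeffs g1A441 z * evalCoeffs g2A441 z = 0} = {0, (1:ℂ)} := by
  ext z
  rw [Set.mem_setOf_eq, eval_g1A441, eval_g2A441, cert_prod_eq_zero_iff (by norm_num) (by norm_num) (by norm_num) (by norm_num) (by norm_num) (by norm_num)]
  simp only [Set.mem_insert_iff, Set.mem_singleton_iff]

/-- Equivalently (441, A): at every complex λ ∉ {0, 1} neither certificate polynomial vanishes. -/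
theorem certificate_generic_441A (z : ℂ) (hz0 : z ≠ 0) (hz1 : z ≠ (1:ℂ)) :
    evalCoeffs g1A441 z ≠ 0 ∧ evalCoeffs g2A441 z ≠ 0 := by
  rw [eval_g1A441, eval_g2A441]
  exact ⟨fun h => by rcases (smul_pow_mul_pow_eq_zero_iff (by norm_num) (by norm_num) (by norm_num)).mp h with h | h <;> contradiction,
         fun h => by rcases (smul_pow_mul_pow_eq_zero_iff (by norm_num) (by norm_num) (by norm_num)).mp h with h | h <;> contradiction⟩

/-- g₁ of implementation B at L441a: gcd of 4 DISTINCT pivot-structure minors of size 9 found at eight λ₀ × five scan orders (its own search). -/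
def g1B441 : List ℤ :=
  [0, 0, 0, -1, 1]

/-- `g1B441` is the coefficient list of λ^3·(λ − (1))^1. -/
theorem eval_g1B441 (z : ℂ) : evalCoeffs g1B441 z = (1:ℂ) * z ^ 3 * (z - (1:ℂ)) ^ 1 := by
  simp [evalCoeffs, g1B441, List.zipIdx]; ring

/-- g₂ of implementation B at L441a: gcd of 4 distinct pivot minors of size 12 of N(λ) = [B | q_sym] over B's CRAMER kernel vectors (a different polynomial from A's g₂ by design; same zero set). -/
def g2B441 : List ℤ :=
  [0, 0, 0, 0, 0, 0, 0, 0, 0, 0, 0, 0, 0, 0, 0, 0, 0, 0, 0, 0, 0, 0, 0, 0, 1, -10, 45, -120, 210, -252, 210, -120, 45, -10, 1]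

/-- `g2B441` is the coefficient list of λ^24·(λ − (1))^10. -/
theorem eval_g2B441 (z : ℂ) : evalCoeffs g2B441 z = (1:ℂ) * z ^ 24 * (z - (1:ℂ)) ^ 10 := by
  simp [evalCoeffs, g2B441, List.zipIdx]; ring

/-- CHARACTERISTIC-0 STATEMENT (cell (4,4,1) at X = L441a, implementation B): the complex zero set of g₁·g₂ — the finite λ (engine normalisation =
geometric, `…Char0` §4) at which the tangent rank or the quadratic-obstruction rank of V_λ at X can drop below its generic value — is exactly {0, 1}. -/
theorem certificate_zero_set_441B : {z : ℂ | evalCoeffs g1B441 z * evalCoeffs g2B441 z = 0} = {0, (1:ℂ)} := by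
  ext z
  rw [Set.mem_setOf_eq, eval_g1B441, eval_g2B441, cert_prod_eq_zero_iff (by norm_num) (by norm_num) (by norm_num) (by norm_num) (by norm_num) (by norm_num)]
  simp only [Set.mem_insert_iff, Set.mem_singleton_iff]

/-- Equivalently (441, B): at every complex λ ∉ {0, 1} neither certificate polynomial vanishes. -/
theorem certificate_generic_441B (z : ℂ) (hz0 : z ≠ 0) (hz1 : z ≠ (1:ℂ)) :
    evalCoeffs g1B441 z ≠ 0 ∧ evalCoeffs g2B441 z ≠ 0 := by
  rw [eval_g1B441, eval_g2B441]
  exact ⟨fun h => by rcases (smul_pow_mul_pow_eq_zero_iff (by norm_num) (by norm_num) (by norm_num)).mp h with h | h <;> contradiction,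
         fun h => by rcases (smul_pow_mul_pow_eq_zero_iff (by norm_num) (by norm_num) (by norm_num)).mp h with h | h <;> contradiction⟩

/-- The two programs' g₁ at L441a are the same polynomial (A: 1 non-zero sampled minor(s); B: 4 distinct pivot minors). -/
theorem g1A441_eq_g1B441 : g1A441 = g1B441 := rfl

/-- g₁ of implementation A at L440b (cell (4,4,0)): gcd of the 1 non-zero among 801 computed 11×11 minors of B(λ) (pivot minors at ten λ₀, then random; normalised), low degree first. -/
def g1A440 : List ℤ :=
  [0, 0, 0, 0, 0, 1]

/-- `g1A440` is the coefficient list of λ^5 (no finite non-zero root). -/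
theorem eval_g1A440 (z : ℂ) : evalCoeffs g1A440 z = (1:ℂ) * z ^ 5 := by
  simp [evalCoeffs, g1A440, List.zipIdx]

/-- g₂ of implementation A at L440b: gcd of the 2 non-zero among 481 computed maximal (size-12) minors of [B(λ) | sym q(λ)] over A's minimal kernel basis (max degree 7). -/
def g2A440 : List ℤ :=
  [0, 0, 0, 0, 0, 0, 1, 1]

/-- `g2A440` is the coefficient list of λ^6·(λ − (-1))^1. -/
theorem eval_g2A440 (z : ℂ) : evalCoeffs g2A440 z = (1:ℂ) * z ^ 6 * (z - (-1:ℂ)) ^ 1 := by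
  simp [evalCoeffs, g2A440, List.zipIdx]; ring

/-- CHARACTERISTIC-0 STATEMENT (cell (4,4,0) at X = L440b, implementation A): the complex zero set of g₁·g₂ — the finite λ (engine normalisation =
geometric, `…Char0` §4) at which the tangent rank or the quadratic-obstruction rank of V_λ at X can drop below its generic value — is exactly {0, -1}. -/
theorem certificate_zero_set_440A : {z : ℂ | evalCoeffs g1A440 z * evalCoeffs g2A440 z = 0} = {0, (-1:ℂ)} := by
  ext z
  rw [Set.mem_setOf_eq, eval_g1A440, eval_g2A440, cert_prod_eq_zero_iff₀ (by norm_num) (by norm_num) (by norm_num) (by norm_num) (by norm_num)]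
  simp only [Set.mem_insert_iff, Set.mem_singleton_iff]

/-- Equivalently (440, A): at every complex λ ∉ {0, -1} neither certificate polynomial vanishes. -/
theorem certificate_generic_440A (z : ℂ) (hz0 : z ≠ 0) (hz1 : z ≠ (-1:ℂ)) :
    evalCoeffs g1A440 z ≠ 0 ∧ evalCoeffs g2A440 z ≠ 0 := by
  rw [eval_g1A440, eval_g2A440]
  exact ⟨fun h => hz0 ((smul_pow_eq_zero_iff (by norm_num) (by norm_num)).mp h),
         fun h => by rcases (smul_pow_mul_pow_eq_zero_iff (by norm_num) (by norm_num) (by norm_num)).mp h with h | h <;> contradiction⟩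

/-- g₁ of implementation B at L440b: gcd of 4 DISTINCT pivot-structure minors of size 11 found at eight λ₀ × five scan orders (its own search). -/
def g1B440 : List ℤ :=
  [0, 0, 0, 0, 0, 1]

/-- `g1B440` is the coefficient list of λ^5 (no finite non-zero root). -/
theorem eval_g1B440 (z : ℂ) : evalCoeffs g1B440 z = (1:ℂ) * z ^ 5 := by
  simp [evalCoeffs, g1B440, List.zipIdx]

/-- g₂ of implementation B at L440b: gcd of 5 distinct pivot minors of size 12 of N(λ) = [B | q_sym] over B's CRAMER kernel vectors (a different polynomial from A's g₂ by design; same zero set). -/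
def g2B440 : List ℤ :=
  [0, 0, 0, 0, 0, 0, 0, 0, 0, 0, 0, 0, 0, 0, 0, 0, 1, 1]

/-- `g2B440` is the coefficient list of λ^16·(λ − (-1))^1. -/
theorem eval_g2B440 (z : ℂ) : evalCoeffs g2B440 z = (1:ℂ) * z ^ 16 * (z - (-1:ℂ)) ^ 1 := by
  simp [evalCoeffs, g2B440, List.zipIdx]; ring

/-- CHARACTERISTIC-0 STATEMENT (cell (4,4,0) at X = L440b, implementation B): the complex zero set of g₁·g₂ — the finite λ (engine normalisation =
geometric, `…Char0` §4) at which the tangent rank or the quadratic-obstruction rank of V_λ at X can drop below its generic value — is exactly {0, -1}. -/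
theorem certificate_zero_set_440B : {z : ℂ | evalCoeffs g1B440 z * evalCoeffs g2B440 z = 0} = {0, (-1:ℂ)} := by
  ext z
  rw [Set.mem_setOf_eq, eval_g1B440, eval_g2B440, cert_prod_eq_zero_iff₀ (by norm_num) (by norm_num) (by norm_num) (by norm_num) (by norm_num)]
  simp only [Set.mem_insert_iff, Set.mem_singleton_iff]

/-- Equivalently (440, B): at every complex λ ∉ {0, -1} neither certificate polynomial vanishes. -/
theorem certificate_generic_440B (z : ℂ) (hz0 : z ≠ 0) (hz1 : z ≠ (-1:ℂ)) :
    evalCoeffs g1B440 z ≠ 0 ∧ evalCoeffs g2B440 z ≠ 0 := by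
  rw [eval_g1B440, eval_g2B440]
  exact ⟨fun h => hz0 ((smul_pow_eq_zero_iff (by norm_num) (by norm_num)).mp h),
         fun h => by rcases (smul_pow_mul_pow_eq_zero_iff (by norm_num) (by norm_num) (by norm_num)).mp h with h | h <;> contradiction⟩

/-- The two programs' g₁ at L440b are the same polynomial (A: 1 non-zero sampled minor(s); B: 4 distinct pivot minors). -/
theorem g1A440_eq_g1B440 : g1A440 = g1B440 := rfl

/-- g₁ of implementation A at L451a (cell (4,5,1)): gcd of the 1 non-zero among 801 computed 21×21 minors of B(λ) (pivot minors at ten λ₀, then random; normalised), low degree first. -/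
def g1A451 : List ℤ :=
  [0, 0, 0, 0, 0, 0, 0, 0, 0, 1, -2, 1]

/-- `g1A451` is the coefficient list of λ^9·(λ − (1))^2. -/
theorem eval_g1A451 (z : ℂ) : evalCoeffs g1A451 z = (1:ℂ) * z ^ 9 * (z - (1:ℂ)) ^ 2 := by
  simp [evalCoeffs, g1A451, List.zipIdx]; ring

/-- g₂ of implementation A at L451a: gcd of the 1 non-zero among 481 computed maximal (size-22) minors of [B(λ) | sym q(λ)] over A's minimal kernel basis (max degree 13). -/
def g2A451 : List ℤ :=
  [0, 0, 0, 0, 0, 0, 0, 0, 0, 0, -1, 3, -3, 1]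

/-- `g2A451` is the coefficient list of λ^10·(λ − (1))^3. -/
theorem eval_g2A451 (z : ℂ) : evalCoeffs g2A451 z = (1:ℂ) * z ^ 10 * (z - (1:ℂ)) ^ 3 := by
  simp [evalCoeffs, g2A451, List.zipIdx]; ring

/-- CHARACTERISTIC-0 STATEMENT (cell (4,5,1) at X = L451a, implementation A): the complex zero set of g₁·g₂ — the finite λ (engine normalisation =
geometric, `…Char0` §4) at which the tangent rank or the quadratic-obstruction rank of V_λ at X can drop below its generic value — is exactly {0, 1}. -/
theorem certificate_zero_set_451A : {z : ℂ | evalCoeffs g1A451 z * evalCoeffs g2A451 z = 0} = {0, (1:ℂ)} := by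
  ext z
  rw [Set.mem_setOf_eq, eval_g1A451, eval_g2A451, cert_prod_eq_zero_iff (by norm_num) (by norm_num) (by norm_num) (by norm_num) (by norm_num) (by norm_num)]
  simp only [Set.mem_insert_iff, Set.mem_singleton_iff]

/-- Equivalently (451, A): at every complex λ ∉ {0, 1} neither certificate polynomial vanishes. -/
theorem certificate_generic_451A (z : ℂ) (hz0 : z ≠ 0) (hz1 : z ≠ (1:ℂ)) :
    evalCoeffs g1A451 z ≠ 0 ∧ evalCoeffs g2A451 z ≠ 0 := by
  rw [eval_g1A451, eval_g2A451]
  exact ⟨fun h => by rcases (smul_pow_mul_pow_eq_zero_iff (by norm_num) (by norm_num) (by norm_num)).mp h with h | h <;> contradiction,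
         fun h => by rcases (smul_pow_mul_pow_eq_zero_iff (by norm_num) (by norm_num) (by norm_num)).mp h with h | h <;> contradiction⟩

/-- g₁ of implementation B at L451a: gcd of 5 DISTINCT pivot-structure minors of size 21 found at eight λ₀ × five scan orders (its own search). -/
def g1B451 : List ℤ :=
  [0, 0, 0, 0, 0, 0, 0, 0, 0, 1, -2, 1]

/-- `g1B451` is the coefficient list of λ^9·(λ − (1))^2. -/
theorem eval_g1B451 (z : ℂ) : evalCoeffs g1B451 z = (1:ℂ) * z ^ 9 * (z - (1:ℂ)) ^ 2 := by
  simp [evalCoeffs, g1B451, List.zipIdx]; ring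

/-- g₂ of implementation B at L451a: gcd of 5 distinct pivot minors of size 22 of N(λ) = [B | q_sym] over B's CRAMER kernel vectors (a different polynomial from A's g₂ by design; same zero set). -/
def g2B451 : List ℤ :=
  [0, 0, 0, 0, 0, 0, 0, 0, 0, 0, 0, 0, 0, 0, 0, 0, 0, 0, 0, 0, 0, 0, 0, 0, 0, 0, 0, 0, -1, 7, -21, 35, -35, 21, -7, 1]

/-- `g2B451` is the coefficient list of λ^28·(λ − (1))^7. -/
theorem eval_g2B451 (z : ℂ) : evalCoeffs g2B451 z = (1:ℂ) * z ^ 28 * (z - (1:ℂ)) ^ 7 := by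
  simp [evalCoeffs, g2B451, List.zipIdx]; ring

/-- CHARACTERISTIC-0 STATEMENT (cell (4,5,1) at X = L451a, implementation B): the complex zero set of g₁·g₂ — the finite λ (engine normalisation =
geometric, `…Char0` §4) at which the tangent rank or the quadratic-obstruction rank of V_λ at X can drop below its generic value — is exactly {0, 1}. -/
theorem certificate_zero_set_451B : {z : ℂ | evalCoeffs g1B451 z * evalCoeffs g2B451 z = 0} = {0, (1:ℂ)} := by
  ext z
  rw [Set.mem_setOf_eq, eval_g1B451, eval_g2B451, cert_prod_eq_zero_iff (by norm_num) (by norm_num) (by norm_num) (by norm_num) (by norm_num) (by norm_num)]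
  simp only [Set.mem_insert_iff, Set.mem_singleton_iff]

/-- Equivalently (451, B): at every complex λ ∉ {0, 1} neither certificate polynomial vanishes. -/
theorem certificate_generic_451B (z : ℂ) (hz0 : z ≠ 0) (hz1 : z ≠ (1:ℂ)) :
    evalCoeffs g1B451 z ≠ 0 ∧ evalCoeffs g2B451 z ≠ 0 := by
  rw [eval_g1B451, eval_g2B451]
  exact ⟨fun h => by rcases (smul_pow_mul_pow_eq_zero_iff (by norm_num) (by norm_num) (by norm_num)).mp h with h | h <;> contradiction,
         fun h => by rcases (smul_pow_mul_pow_eq_zero_iff (by norm_num) (by norm_num) (by norm_num)).mp h with h | h <;> contradiction⟩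

/-- The two programs' g₁ at L451a are the same polynomial (A: 1 non-zero sampled minor(s); B: 5 distinct pivot minors). -/
theorem g1A451_eq_g1B451 : g1A451 = g1B451 := rfl

/-! ## 2b. The characteristic-0 factorisations coincide with the generation-21 rows modulo p at random X (`ExSet632.exRows`) -/

/-- Implementation B's characteristic-0 factorisations at the three sparse rational points, as (d, m, roots-with-multiplicity of g₁, of g₂) in the format of
`ExSet632.ExRow` (generated from `g1B…`, `g2B…` above: L441a: g₁ = λ³(λ−1), g₂ = λ²⁴(λ−1)¹⁰; L440b: g₁ = λ⁵, g₂ = λ¹⁶(λ+1); L451a: g₁ = λ⁹(λ−1)², g₂ = λ²⁸(λ−1)⁷). -/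
def char0FactorsB : List (ℕ × ℕ × List (ℤ × ℕ) × List (ℤ × ℕ)) :=
  [(4, 1, [(0,3), (1,1)], [(0,24), (1,10)]), (4, 0, [(0,5)], [(0,16), (-1,1)]), (5, 1, [(0,9), (1,2)], [(0,28), (1,7)])]

/-- OBSERVATION (kernel-checked bookkeeping, no claim beyond the instances): every generation-21 exsetE row of a FOURFOLD cell — program exsetE.py modulo
1000003 at RANDOM smooth quartics/quintic containing the planes (kit j137462; `ExSet632.exRows`) — has exactly the (g₁, G₂) factorisation that implementation B
finds in characteristic 0 at the sparse rational point of the same cell: the certificate polynomials do not see the difference between these X. -/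
theorem exRows_fourfold_eq_char0 :
    ∀ r ∈ exRows, r.n = 4 → (r.d, r.m, r.g1, r.G2) ∈ char0FactorsB := by decide

/-- The finite non-zero exceptional value in characteristic 0 obeys the census sign rule (−1)^(n/2 − m + 1) (`ExSet632.signRule`): +1 in (4,4,1) and (4,5,1), −1 in (4,4,0). -/
theorem char0_signRule_fourfolds : (signRule 4 1, signRule 4 0) = (1, -1) ∧
    (([0, 1] : List ℤ), ([-1, 0] : List ℤ), ([0, 1] : List ℤ)) = ([0, signRule 4 1], [signRule 4 0, 0], [0, signRule 4 1]) := by decide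

end Summit.HodgeConjecture.HodgeConjecture.HodgeLocus.Census.ExSet44Char0
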